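import Literature.NumberTheory.Irrationality.LaiLupuSprang2025.InfinityExpansion
import Literature.NumberTheory.Irrationality.LaiLupuSprang2025.PhiRate
import Literature.NumberTheory.Irrationality.LaiLupuSprang2025.ArchimedeanBounds
import Literature.NumberTheory.Irrationality.PAdicZetaValues.Criterion
import Literature.NumberTheory.Transcendental.ZetaLinearFormsCriterion
import HarnessLib

/-!
# Lai–Lupu–Sprang 2025, Theorem 1.1 (§8 "Proof of the main theorem") — the DISCHARGE of
# `PAdicZetaValues.laiLupuSprang2025_theorem11`

Topic `Literature/NumberTheory/Irrationality/LaiLupuSprang2025`.  Source: L. Lai, C. Lupu, J. Sprang, *On the irrationality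
of certain `p`-adic zeta values*, Res. Math. Sci. 12 (2025) = arXiv:2505.23088 [LaiLupuSprang2025], §6 ((def:n(N)), (def:I))
and §8 (held text `paper:arxiv-2505.23088`, chunks p0009, p0012, read on the page).  PROOF FILE (theorems + the printed
parameters as definitions; no named fact; net debt −1): the last file of the discharge, assembling `RationalFunction.lean`
(§3–§5), `PhiFactor.lean`/`PhiRate.lean` (Lemmas 5.4–5.7, 7.3–7.4), `LinearForms.lean` (§4), `PoleExpansion.lean` and
`InfinityExpansion.lean` (§6), `ArchimedeanBounds.lean` (Lemma 7.1), the tree's criterion `PAdicZetaValues.Criterion`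
(Lemma 2.1) and `d_n = e^{n+o(n)}` (`Transcendental.tendsto_log_lcmUpto_div`, the prime number theorem).

## Source, as printed ([LaiLupuSprang2025, §8])

«*Proof of Theorem 1.1.* For any integer `n` in the set `I` defined by (def:I), we define `Λ_n := Φ_n^{−1}d_n^{p−1+s}·S_n`.
Then Lemma 4.5 implies `Λ_n = ρ̂_0 + Σ_{3≤i≤p−1+s, i odd} ρ̂_i·p^i ζ_p(i)`, where `ρ̂_i = Φ_n^{−1}d_n^{p−1+s}·ρ_i`.  By Lemma 4.1,
Lemma 5.5 and Lemma 5.7, we have `ρ̂_i ∈ ℤ` … As `n ∈ I` and `n → ∞`, by Eq. (d_n_Archi), Lemma 7.1 and Lemma 7.3, we have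
`max_i |ρ̂_i| ≤ 2^{sn}·p^{pn}·e^{(p−1+s−ϖ_p)n+o(n)}`.  On the other hand, Lemma 6.3 implies `|Λ_n|_p = p^{−(p+ps/(p−1))n+o(n)}`,
and `Λ_n ≠ 0` for `n ∈ I`.  Therefore, if the positive integer `s` satisfies `2^s p^p e^{p−1+s−ϖ_p} p^{−(p+ps/(p−1))} < 1`
[(sss)], then `max_i |ρ̂_i|·|Λ_n|_p → 0` as `n ∈ I` and `n → ∞`, and Lemma 2.1 will imply that there exists an odd integer
`i ∈ [3, p−1+s]` such that `ζ_p(i)` is irrational.  Take `s = ⌊(p−1−ϖ_p)/((p/(p−1))log p − 1 − log 2)⌋ + 1`, which is the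
smallest integer satisfying (sss).  By Lemma 7.4 and `p ≥ 5` we know that this `s` is positive.  Then we conclude that there
exists an odd integer `i ∈ [3, c_p]` such that `ζ_p(i)` is irrational, where `c_p = p + (p−1−ϖ_p)/((p/(p−1))log p − 1 − log 2)`.»

## What is formalised (all PROVED)

* §1 the parameters: `llsD p` (the denominator of `c_p`), `sPar p = ⌊(p−1−ϖ_p)/D_p⌋₊ + 1` with `one_le_sPar`,
  `key_exponent_neg` ((sss) in logarithmic form: `(p−1−ϖ_p) − s·D_p < 0`) and `pred_add_sPar_le_llsC` (`p−1+s ≤ c_p`);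
* §2 the index sequence `Nseq`, `nseq` ((def:n(N)) along `N ≡ 2+N₀ (mod φ(m'))`, «infinitely many `N` with
  `p^N ≡ p^{2+N₀} (mod p−1+s)`») with `nseq_spec` (`(n+1)(p−1+s) = p^N(p−1)+1+M₀`), `nseq_deg` (the degree condition with
  room) and `tendsto_nseq`;
* §3 the linear forms: `xiVec`, `lVec` (`ρ̂_0`, `ρ̂_i p^i` as integers, Lemmas 5.5/5.7), `sum_lVec_eq` (`Σ_i l_i ξ_i = Φ_n^{−1}d_n^{p−1+s}S_n`,
  Lemma 4.5), `sum_lVec_ne_zero` (Lemma 6.3);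
* §4 the estimate `eventually_lVec_bound` (`max_i|l_i|·|Λ_n|_p ≤ C·e^{κn/2}`, `κ < 0`, from Lemma 6.3 = `norm_Sn`, Lemma 7.1,
  Lemma 7.3 = `eventually_exp_le_PhiL`, the prime number theorem for `d_n`, and Legendre's formula for `v_p(n!)`), and
* §5 **`PAdicZetaValues.laiLupuSprang2025_theorem11_holds`**.

Cell zeta5-irr / pub-zeta5 (HONEST FRAMING: systematic search; no irrationality claim unless kernel-certified): this
kernel-certifies a PUBLISHED `p`-adic theorem (`ζ_p(i) ∉ ℚ` for some odd `i ≤ c_p`, every prime `p ≥ 5`); nothing here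
bears on `ζ(5) ∈ ℝ`.
-/

noncomputable section

open Finset Filter Topology
open scoped Nat
open Literature.NumberTheory.Irrationality.PAdicZetaValues

namespace Literature.NumberTheory.Irrationality.LaiLupuSprang2025

/-! ## §1. The parameters `D_p`, `s = s_p` and the inequality (sss) -/

/-- `D_p := (p/(p−1)) log p − 1 − log 2`, the denominator in `c_p`. [cite: LaiLupuSprang2025, Theorem 1.1 (c_p) and §8] -/
def llsD (p : ℕ) : ℝ := (p : ℝ) / (p - 1) * Real.log p - 1 - Real.log 2

/-- **`s := ⌊(p−1−ϖ_p)/D_p⌋ + 1`** («the smallest integer satisfying (sss)»). [cite: LaiLupuSprang2025, §8 ("Take s = ⌊…⌋ + 1")] -/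
def sPar (p : ℕ) : ℕ := ⌊((p : ℝ) - 1 - llsVarpi p) / llsD p⌋₊ + 1

/-- `s ≥ 1`. [cite: LaiLupuSprang2025, §8 ("this s is positive")] -/
theorem one_le_sPar (p : ℕ) : 1 ≤ sPar p := by unfold sPar; omega

/-- `0 ≤ (p−1−ϖ_p)/D_p` for `p ≥ 5` (Lemma 7.4 and `D_p > 0`). [cite: LaiLupuSprang2025, §8 and Lemma 7.4] -/
theorem ratio_nonneg {p : ℕ} (hp : 5 ≤ p) : 0 ≤ ((p : ℝ) - 1 - llsVarpi p) / llsD p := by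
  have h1 := llsVarpi_lt (p := p) (by omega)
  have h2 := llsDenom_pos hp
  rw [llsD]
  exact div_nonneg (by linarith) h2.le

/-- **(sss) in logarithmic form: `κ_p := (p−1−ϖ_p) − s·D_p < 0`.** [cite: LaiLupuSprang2025, §8 (sss)] -/
theorem key_exponent_neg {p : ℕ} (hp : 5 ≤ p) : ((p : ℝ) - 1 - llsVarpi p) - (sPar p : ℝ) * llsD p < 0 := by
  have hD := llsDenom_pos hp
  have hlt := Nat.lt_floor_add_one (((p : ℝ) - 1 - llsVarpi p) / llsD p)
  rw [sPar, llsD] at *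
  push_cast
  rw [div_lt_iff₀ hD] at hlt
  linarith

/-- `p − 1 + s ≤ c_p` (so every odd `i ≤ p−1+s` lies in `[3, c_p]`). [cite: LaiLupuSprang2025, §8 ("an odd integer i ∈ [3, c_p]")] -/
theorem pred_add_sPar_le_llsC {p : ℕ} (hp : 5 ≤ p) : (((p - 1 + sPar p : ℕ) : ℝ)) ≤ llsC p := by
  have h := Nat.floor_le (ratio_nonneg hp)
  rw [llsC, show (p : ℝ) / (p - 1) * Real.log p - 1 - Real.log 2 = llsD p from rfl]
  have hp1 : 1 ≤ p := by omega
  push_cast [Nat.cast_sub hp1, sPar]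
  linarith

/-! ## §2. The index sequence: `N ≡ 2 + N₀ (mod φ(m'))` and `n = n(N)` of (def:n(N)) -/

/-- `m' := (p−1+s)/p^{N₀}`, the prime-to-`p` part of `p−1+s`. [cite: LaiLupuSprang2025, §6 ("there are infinitely many positive integers N with p^N ≡ p^{2+N_0} mod p−1+s")] -/
def mPrime (p s : ℕ) : ℕ := (p - 1 + s) / p ^ N0 p s

/-- `p^{N₀}·m' = p−1+s` and `p ∤ m'`. [cite: LaiLupuSprang2025, §3 (N_0 = v_p(p−1+s)) and §6] -/
theorem mPrime_spec {p : ℕ} [hpr : Fact p.Prime] {s : ℕ} (hs : 1 ≤ s) :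
    p ^ N0 p s * mPrime p s = p - 1 + s ∧ ¬ p ∣ mPrime p s := by
  have hA : p - 1 + s ≠ 0 := by omega
  have hdvd : p ^ N0 p s ∣ p - 1 + s := by rw [N0]; exact pow_padicValNat_dvd
  refine ⟨by rw [mPrime, Nat.mul_div_cancel' hdvd], fun h => ?_⟩
  have : p ^ (N0 p s + 1) ∣ p - 1 + s := by
    rw [pow_succ, ← Nat.mul_div_cancel' hdvd, mPrime] at *
    exact Nat.mul_dvd_mul_left _ h
  exact pow_succ_padicValNat_not_dvd hA (by rw [N0] at this; exact this)

/-- **The exponents `N_k := 2 + N₀ + k·φ(m')`** (so `p^{N_k} ≡ p^{2+N₀} (mod p−1+s)`). [cite: LaiLupuSprang2025, §6 (def:n(N))] -/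
def Nseq (p s k : ℕ) : ℕ := 2 + N0 p s + k * Nat.totient (mPrime p s)

/-- `N_k ≥ 1`. [cite: LaiLupuSprang2025, §6] -/
theorem one_le_Nseq (p s k : ℕ) : 1 ≤ Nseq p s k := by unfold Nseq; omega

/-- `N_k ≥ k`. [cite: LaiLupuSprang2025, §6 ("n(N) → ∞ as N → ∞")] -/
theorem le_Nseq {p : ℕ} [hpr : Fact p.Prime] {s : ℕ} (hs : 1 ≤ s) (k : ℕ) : k ≤ Nseq p s k := by
  have hm : 0 < mPrime p s := by
    have := (mPrime_spec (p := p) hs).1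
    rcases Nat.eq_zero_or_pos (mPrime p s) with h | h
    · rw [h, mul_zero] at this; omega
    · exact h
  have ht : 1 ≤ Nat.totient (mPrime p s) := Nat.totient_pos.2 hm
  unfold Nseq; nlinarith

/-- **`p−1+s ∣ p^{N_k}(p−1) + M₀ + 1`** (`M₀ + 1 = p^{2+N₀}s`, `p^{N_k} ≡ p^{2+N₀}` modulo `m'` by Euler and modulo `p^{N₀}`
trivially): «`p^N(p−1) + M₀ + 1 ≡ 0 (mod p−1+s)`». [cite: LaiLupuSprang2025, §6 (before (def:n(N)))] -/
theorem dvd_index {p : ℕ} [hpr : Fact p.Prime] {s : ℕ} (hs : 1 ≤ s) (k : ℕ) :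
    (p - 1 + s) ∣ p ^ Nseq p s k * (p - 1) + M0 p s + 1 := by
  obtain ⟨hA, hnd⟩ := mPrime_spec (p := p) hs
  have hp1 : 1 ≤ p := hpr.out.one_lt.le
  have hM : M0 p s + 1 = p ^ (2 + N0 p s) * s := by
    rw [M0, Nat.sub_add_cancel]
    exact Nat.one_le_iff_ne_zero.2 (Nat.mul_ne_zero (pow_ne_zero _ hpr.out.ne_zero) (by omega))
  -- `p^{N_k}(p−1) + p^{2+N₀}s = p^{N₀}·(p²·((p^φ)^k(p−1) + s))`
  set L := Nat.totient (mPrime p s) with hL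
  have hcop : Nat.Coprime p (mPrime p s) := (Nat.Prime.coprime_iff_not_dvd hpr.out).2 hnd
  have heuler : (p ^ L) ^ k ≡ 1 [MOD mPrime p s] := by
    have := (Nat.ModEq.pow_totient hcop).pow k
    rwa [one_pow] at this
  have hbr : mPrime p s ∣ (p ^ L) ^ k * (p - 1) + s := by
    have h1 : (p ^ L) ^ k * (p - 1) + s ≡ 1 * (p - 1) + s [MOD mPrime p s] := (heuler.mul_right _).add_right _
    rw [one_mul, ← hA] at h1
    have h2 : p ^ N0 p s * mPrime p s ≡ 0 [MOD mPrime p s] := Nat.modEq_zero_iff_dvd.2 (dvd_mul_left _ _)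
    exact Nat.modEq_zero_iff_dvd.1 (h1.trans h2)
  have e : p ^ Nseq p s k * (p - 1) + M0 p s + 1 = p ^ N0 p s * (p ^ 2 * ((p ^ L) ^ k * (p - 1) + s)) := by
    rw [add_assoc, hM, Nseq, ← hL]
    ring
  rw [e, ← hA]
  exact Nat.mul_dvd_mul_left _ (dvd_mul_of_dvd_right hbr _)

/-- **`n_k := n(N_k) = (p^{N_k}(p−1) + M₀ + 1)/(p−1+s) − 1`** ((def:n(N))). [cite: LaiLupuSprang2025, §6 (def:n(N))] -/
def nseq (p s k : ℕ) : ℕ := (p ^ Nseq p s k * (p - 1) + M0 p s + 1) / (p - 1 + s) - 1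

/-- **«`(n(N)+1)(p−1+s) − M₀ = p^N(p−1)+1`»**. [cite: LaiLupuSprang2025, §6 ("The key point of the above definitions")] -/
theorem nseq_spec {p : ℕ} [hpr : Fact p.Prime] {s : ℕ} (hs : 1 ≤ s) (k : ℕ) :
    (nseq p s k + 1) * (p - 1 + s) = p ^ Nseq p s k * (p - 1) + 1 + M0 p s := by
  have hA0 : 0 < p - 1 + s := by omega
  obtain ⟨q, hq⟩ := dvd_index (p := p) hs k
  have hq1 : 1 ≤ q := by
    rcases Nat.eq_zero_or_pos q with h | h
    · rw [h, mul_zero] at hq; omega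
    · exact h
  rw [nseq, hq, Nat.mul_div_cancel_left _ hA0, Nat.sub_add_cancel hq1, mul_comm]
  omega

/-- The degree condition with room along the sequence: `M₀ + (p−1)n_k + 2 ≤ (p−1+s)(n_k+1)` (from `N_k ≥ 2 + N₀`, i.e.
`n_k + 1 ≤ p^{N_k}`). [cite: LaiLupuSprang2025, §6 (def:I) and Lemma 4.1] -/
theorem nseq_deg {p : ℕ} [hpr : Fact p.Prime] {s : ℕ} (hs : 1 ≤ s) (k : ℕ) :
    M0 p s + (p - 1) * nseq p s k + 2 ≤ (p - 1 + s) * (nseq p s k + 1) := by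
  have hp2 : 2 ≤ p := hpr.out.two_le
  have hsp := nseq_spec (p := p) hs k
  set n := nseq p s k
  set N := Nseq p s k with hN
  have hM : M0 p s + 1 = p ^ (2 + N0 p s) * s := by
    rw [M0, Nat.sub_add_cancel]
    exact Nat.one_le_iff_ne_zero.2 (Nat.mul_ne_zero (pow_ne_zero _ hpr.out.ne_zero) (by omega))
  have hpow : p ^ (2 + N0 p s) ≤ p ^ N := Nat.pow_le_pow_right (by omega) (by rw [hN, Nseq]; omega)
  -- `(n+1)(p−1+s) ≤ p^N (p−1+s)`, hence `n + 1 ≤ p^N`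
  have h1 : (n + 1) * (p - 1 + s) ≤ p ^ N * (p - 1 + s) := by
    have : M0 p s + 1 ≤ p ^ N * s := by rw [hM]; exact Nat.mul_le_mul_right _ hpow
    have e : p ^ N * (p - 1 + s) = p ^ N * (p - 1) + p ^ N * s := by rw [Nat.mul_add]
    rw [hsp, e]; omega
  have h2 : n + 1 ≤ p ^ N := Nat.le_of_mul_le_mul_right h1 (by omega)
  have h3 : (p - 1) * (n + 1) ≤ (p - 1) * p ^ N := Nat.mul_le_mul_left _ h2
  rw [Nat.mul_comm (p - 1 + s), hsp]
  have : (p - 1) * (n + 1) = (p - 1) * n + (p - 1) := by ring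
  have : (p - 1) * p ^ N = p ^ N * (p - 1) := Nat.mul_comm _ _
  omega

/-- `n_k → ∞`. [cite: LaiLupuSprang2025, §6 ("n(N) → ∞ as N → ∞ … I is an unbounded subset of ℕ")] -/
theorem tendsto_nseq {p : ℕ} [hpr : Fact p.Prime] {s : ℕ} (hs : 1 ≤ s) : Tendsto (nseq p s) atTop atTop := by
  have hp2 : 2 ≤ p := hpr.out.two_le
  have hA0 : 0 < p - 1 + s := by omega
  refine tendsto_atTop_atTop.2 fun b => ⟨(p - 1 + s) * (b + 1), fun k hk => ?_⟩
  have hsp := nseq_spec (p := p) hs k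
  have hN := le_Nseq (p := p) hs k
  -- `p^{N_k} ≥ 2^{N_k} > N_k ≥ k`
  have hpow : k + 1 ≤ p ^ Nseq p s k :=
    calc k + 1 ≤ Nseq p s k + 1 := by omega
      _ ≤ 2 ^ Nseq p s k := Nat.lt_two_pow_self
      _ ≤ p ^ Nseq p s k := Nat.pow_le_pow_left hp2 _
  have h1 : p ^ Nseq p s k ≤ p ^ Nseq p s k * (p - 1) := Nat.le_mul_of_pos_right _ (by omega)
  have h2 : (b + 1) * (p - 1 + s) < (nseq p s k + 1) * (p - 1 + s) := by
    rw [hsp, mul_comm]; omega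
  have := Nat.lt_of_mul_lt_mul_right h2
  omega

/-! ## §3. The linear forms `Λ_n = ρ̂_0 + Σ_{odd i} ρ̂_i p^i ζ_p(i)` with integer coefficients -/

section LinearForms

variable {p : ℕ} [hpr : Fact p.Prime]

/-- `T_n := d_n^{p−1+s}/Φ_n ∈ ℚ`. [cite: LaiLupuSprang2025, §8 ("Λ_n := Φ_n^{−1} d_n^{p−1+s} · S_n")] -/
def Tfac (p s n : ℕ) : ℚ := (Nat.lcmUpto n : ℚ) ^ (p - 1 + s) / (PhiL p n : ℚ)

/-- `T_n > 0`. [cite: LaiLupuSprang2025, §8] -/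
theorem Tfac_pos (p s n : ℕ) : 0 < Tfac p s n := by
  unfold Tfac
  exact div_pos (pow_pos (by exact_mod_cast Nat.lcmUpto_pos n) _) (by exact_mod_cast PhiL_pos p n)

/-- **`ρ̂_i := Φ_n^{−1}d_n^{p−1+s}ρ_i ∈ ℤ`** (Lemmas 4.1, 5.5), as an integer-valued function (junk `0` off the
hypotheses). [cite: LaiLupuSprang2025, §8 ("ρ̂_i ∈ ℤ"), Lemma 5.5] -/
def rhoHat (p s n i : ℕ) : ℤ :=
  if h : p.Prime ∧ 1 ≤ s then (exists_int_phi_rho' h.1 h.2 n i).choose else 0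

/-- `ρ̂_i = T_n ρ_i`. [cite: LaiLupuSprang2025, §8, Lemma 5.5] -/
theorem rhoHat_spec {s : ℕ} (hs : 1 ≤ s) (n i : ℕ) : (rhoHat p s n i : ℚ) = Tfac p s n * rho p s n i := by
  have h : p.Prime ∧ 1 ≤ s := ⟨hpr.out, hs⟩
  rw [rhoHat, dif_pos h, ← (exists_int_phi_rho' h.1 h.2 n i).choose_spec, Tfac]
  ring

/-- **`ρ̂_0 := Φ_n^{−1}d_n^{p−1+s}ρ_0 ∈ ℤ`** (Lemma 5.7), integer-valued (junk `0` off the hypotheses).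
[cite: LaiLupuSprang2025, §8 ("ρ̂_i ∈ ℤ"), Lemma 5.7] -/
def rhoHatZero (p s n : ℕ) : ℤ :=
  if h : p.Prime ∧ 1 ≤ s ∧ M0 p s + (p - 1) * n < (p - 1 + s) * (n + 1) then
    (exists_int_phi_rhoZero h.1 h.2.1 n h.2.2).choose else 0

/-- `ρ̂_0 = T_n ρ_0`. [cite: LaiLupuSprang2025, §8, Lemma 5.7] -/
theorem rhoHatZero_spec {s : ℕ} (hs : 1 ≤ s) {n : ℕ} (hdeg : M0 p s + (p - 1) * n < (p - 1 + s) * (n + 1)) :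
    (rhoHatZero p s n : ℚ) = Tfac p s n * rhoZero p s n := by
  have h : p.Prime ∧ 1 ≤ s ∧ M0 p s + (p - 1) * n < (p - 1 + s) * (n + 1) := ⟨hpr.out, hs, hdeg⟩
  rw [rhoHatZero, dif_pos h, ← (exists_int_phi_rhoZero h.1 h.2.1 n h.2.2).choose_spec, Tfac]
  ring

/-- The numbers `ξ = (1, (ζ_p(i))_{3 ≤ i ≤ p−1+s odd})`, indexed by `Fin (p−1+s+1)` (`0 ↦ 1`, odd `i ≥ 3 ↦ ζ_p(i)`, other
indices `↦ 0`). [cite: LaiLupuSprang2025, §8 (Lemma 2.1 applied to 1 and the ζ_p(i))] -/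
def xiVec (p : ℕ) [Fact p.Prime] (A : ℕ) : Fin (A + 1) → ℚ_[p] := fun i =>
  if i.val = 0 then 1 else if Odd i.val ∧ 3 ≤ i.val then padicZetaValue p i.val else 0

/-- The integer coefficients `(ρ̂_0, (ρ̂_i p^i)_{odd i ≥ 3})` of `Λ_n`. [cite: LaiLupuSprang2025, §8 ("Λ_n = ρ̂_0 + Σ ρ̂_i p^i ζ_p(i)")] -/
def lVec (p s n : ℕ) : Fin (p - 1 + s + 1) → ℤ := fun i =>
  if i.val = 0 then rhoHatZero p s n else if Odd i.val ∧ 3 ≤ i.val then rhoHat p s n i.val * (p : ℤ) ^ i.val else 0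

/-- The odd indices `3 ≤ i ≤ A` as a filter of `Ico 1 (A+1)`. [cite: LaiLupuSprang2025, §8] -/
theorem filter_odd_eq (A : ℕ) :
    (Ico 1 (A + 1)).filter (fun i => Odd i ∧ 3 ≤ i) = (Icc 2 A).filter (fun i => Odd i) := by
  ext i
  simp only [mem_filter, mem_Ico, mem_Icc]
  constructor
  · rintro ⟨⟨-, h2⟩, hodd, h3⟩; exact ⟨⟨by omega, by omega⟩, hodd⟩
  · rintro ⟨⟨h1, h2⟩, hodd⟩
    refine ⟨⟨by omega, by omega⟩, hodd, ?_⟩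
    rcases hodd with ⟨k, hk⟩; omega

/-- **`Λ_n = Σ_i l_i ξ_i = T_n·S_n`** (Lemma 4.5 = `Sn_eq`, times `T_n = Φ_n^{−1}d_n^{p−1+s}`).
[cite: LaiLupuSprang2025, §8 ("Then Lemma 4.5 implies Λ_n = ρ̂_0 + Σ ρ̂_i · p^i ζ_p(i)")] -/
theorem sum_lVec_eq (hp5 : 5 ≤ p) {s : ℕ} (hs : 1 ≤ s) {n : ℕ}
    (hdeg2 : M0 p s + (p - 1) * n + 2 ≤ (p - 1 + s) * (n + 1)) :
    ∑ i, (lVec p s n i : ℚ_[p]) * xiVec p (p - 1 + s) i = ((Tfac p s n : ℚ) : ℚ_[p]) * Sn p s n := by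
  have hdeg : M0 p s + (p - 1) * n < (p - 1 + s) * (n + 1) := by omega
  set A := p - 1 + s with hA
  -- pass to a sum over `range (A+1)` and split off `i = 0`
  have hsum : ∑ i, (lVec p s n i : ℚ_[p]) * xiVec p A i =
      ∑ v ∈ range (A + 1), ((if v = 0 then rhoHatZero p s n
        else if Odd v ∧ 3 ≤ v then rhoHat p s n v * (p : ℤ) ^ v else 0 : ℤ) : ℚ_[p]) *
        (if v = 0 then (1 : ℚ_[p]) else if Odd v ∧ 3 ≤ v then padicZetaValue p v else 0) :=
    Fin.sum_univ_eq_sum_range (fun v => ((if v = 0 then rhoHatZero p s n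
        else if Odd v ∧ 3 ≤ v then rhoHat p s n v * (p : ℤ) ^ v else 0 : ℤ) : ℚ_[p]) *
        (if v = 0 then (1 : ℚ_[p]) else if Odd v ∧ 3 ≤ v then padicZetaValue p v else 0)) (A + 1)
  set g : ℕ → ℚ_[p] := fun v => ((if v = 0 then rhoHatZero p s n
        else if Odd v ∧ 3 ≤ v then rhoHat p s n v * (p : ℤ) ^ v else 0 : ℤ) : ℚ_[p]) *
        (if v = 0 then (1 : ℚ_[p]) else if Odd v ∧ 3 ≤ v then padicZetaValue p v else 0) with hg
  rw [hsum]
  change ∑ v ∈ range (A + 1), g v = _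
  have h0 : ∑ v ∈ range (A + 1), g v = g 0 + ∑ v ∈ Ico 1 (A + 1), g v := by
    rw [sum_range_succ', Finset.sum_Ico_eq_sum_range, show A + 1 - 1 = A by omega, add_comm]
    congr 1
    exact sum_congr rfl fun k _ => by rw [add_comm]
  have hg0 : g 0 = ((Tfac p s n : ℚ) : ℚ_[p]) * ((rhoZero p s n : ℚ) : ℚ_[p]) := by
    simp only [hg, if_true, mul_one]
    rw [← Rat.cast_intCast, rhoHatZero_spec hs hdeg, Rat.cast_mul]
  have hgv : ∀ v ∈ Ico 1 (A + 1), g v = if Odd v ∧ 3 ≤ v then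
      ((Tfac p s n : ℚ) : ℚ_[p]) * (((rho p s n v : ℚ) : ℚ_[p]) * ((p : ℚ_[p]) ^ v * padicZetaValue p v)) else 0 := by
    intro v hv
    have hv0 : v ≠ 0 := by have := (mem_Ico.1 hv).1; omega
    simp only [hg, if_neg hv0]
    split_ifs with hodd
    · push_cast
      rw [← Rat.cast_intCast, rhoHat_spec hs n v, Rat.cast_mul]
      ring
    · simp
  rw [h0, hg0, sum_congr rfl hgv, ← sum_filter, filter_odd_eq, Sn_eq (by omega) s n hdeg2, mul_add, mul_sum]

/-- **`Λ_n ≠ 0` along `n = n(N)`** (Lemma 6.3 and `T_n ≠ 0`). [cite: LaiLupuSprang2025, §8 ("Λ_n ≠ 0 for n ∈ I"), Lemma 6.3] -/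
theorem sum_lVec_ne_zero (hp5 : 5 ≤ p) {s : ℕ} (hs : 1 ≤ s) (k : ℕ) :
    ∑ i, (lVec p s (nseq p s k) i : ℚ_[p]) * xiVec p (p - 1 + s) i ≠ 0 := by
  rw [sum_lVec_eq hp5 hs (nseq_deg hs k)]
  refine mul_ne_zero (by exact_mod_cast (Tfac_pos p s (nseq p s k)).ne') ?_
  exact Sn_ne_zero hs (one_le_Nseq p s k) (nseq_spec hs k) (nseq_deg hs k)


/-! ## §4. The sizes: `|l_i| ≤ T_n p^{p−1+s} max(|ρ_0|, |ρ_i|)`, `|Λ_n|_p ≤ |S_n|_p`, and the exponential bookkeeping -/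

/-- `p ∤ Φ_n` (the primes of `Φ_n` exceed `√(pn) ≥ p` or `p ∉ (√(pn), n]`), so `‖Φ_n‖_p = 1`.
[cite: LaiLupuSprang2025, §8 ("|Λ_n|_p = p^{−(p+ps/(p−1))n+o(n)}": Φ_n^{−1} does not change the p-adic size)] -/
theorem norm_PhiL_eq_one (n : ℕ) : ‖((PhiL p n : ℕ) : ℚ_[p])‖ = 1 := by
  have hnot : p ∉ phiPrimes p n := fun h => by
    obtain ⟨h1, -, h3⟩ := mem_phiPrimes.1 h
    have : p * n < p * n := lt_of_lt_of_le h3 (Nat.mul_le_mul_left _ h1)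
    exact lt_irrefl _ this
  have hv := padicValNat_PhiL_of_not_mem (q := p) hnot
  have hnd : ¬ p ∣ PhiL p n := by
    rcases padicValNat.eq_zero_iff.1 hv with h | h | h
    · exact absurd h hpr.out.one_lt.ne'
    · exact absurd h (PhiL_pos p n).ne'
    · exact h
  have hz : ¬ (p : ℤ) ∣ ((PhiL p n : ℕ) : ℤ) := fun h => hnd (by exact_mod_cast h)
  have h1 : ‖(((PhiL p n : ℕ) : ℤ) : ℚ_[p])‖ = 1 :=
    le_antisymm (Padic.norm_int_le_one _) (not_lt.mp fun h => hz (Padic.norm_intCast_lt_one_iff.mp h))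
  exact_mod_cast h1

/-- `‖T_n‖_p ≤ 1` (`d_n^{p−1+s} ∈ ℕ`, `‖Φ_n‖_p = 1`). [cite: LaiLupuSprang2025, §8] -/
theorem norm_Tfac_le_one (s n : ℕ) : ‖((Tfac p s n : ℚ) : ℚ_[p])‖ ≤ 1 := by
  rw [Tfac, Rat.cast_div, norm_div, Rat.cast_natCast, norm_PhiL_eq_one, div_one, Rat.cast_pow, Rat.cast_natCast, norm_pow]
  exact pow_le_one₀ (norm_nonneg _) (by simpa using Padic.norm_int_le_one (p := p) (Nat.lcmUpto n : ℤ))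

/-- **`|Λ_n|_p ≤ |S_n|_p`**. [cite: LaiLupuSprang2025, §8 ("|Λ_n|_p = p^{−(p+ps/(p−1))n+o(n)}")] -/
theorem norm_sum_lVec_le (hp5 : 5 ≤ p) {s : ℕ} (hs : 1 ≤ s) (k : ℕ) :
    ‖∑ i, (lVec p s (nseq p s k) i : ℚ_[p]) * xiVec p (p - 1 + s) i‖ ≤ ‖Sn p s (nseq p s k)‖ := by
  rw [sum_lVec_eq hp5 hs (nseq_deg hs k), norm_mul]
  calc ‖((Tfac p s (nseq p s k) : ℚ) : ℚ_[p])‖ * ‖Sn p s (nseq p s k)‖ ≤ 1 * ‖Sn p s (nseq p s k)‖ := by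
        gcongr; exact norm_Tfac_le_one s _
    _ = _ := one_mul _

/-- **`|l_i| ≤ T_n·p^{p−1+s}·R`** whenever `|ρ_0| ≤ R` and `|ρ_i| ≤ R` for all `i`. [cite: LaiLupuSprang2025, §8 ("max_i |ρ̂_i| ≤ …")] -/
theorem abs_lVec_le {s : ℕ} (hs : 1 ≤ s) {n : ℕ} (hdeg : M0 p s + (p - 1) * n < (p - 1 + s) * (n + 1)) {R : ℝ}
    (h0 : ((|rhoZero p s n| : ℚ) : ℝ) ≤ R) (hi : ∀ i, ((|rho p s n i| : ℚ) : ℝ) ≤ R) (i : Fin (p - 1 + s + 1)) :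
    (|lVec p s n i| : ℝ) ≤ (Tfac p s n : ℝ) * (p : ℝ) ^ (p - 1 + s) * R := by
  have hT : (0 : ℝ) < (Tfac p s n : ℝ) := by exact_mod_cast Tfac_pos p s n
  have hR : 0 ≤ R := le_trans (by positivity) h0
  have hp1 : (1 : ℝ) ≤ p := by exact_mod_cast hpr.out.one_lt.le
  have hpA : (1 : ℝ) ≤ (p : ℝ) ^ (p - 1 + s) := one_le_pow₀ hp1
  unfold lVec
  split_ifs with h1 h2
  · -- `i = 0`: `|ρ̂_0| = T|ρ_0|`
    have e : ((rhoHatZero p s n : ℤ) : ℝ) = (Tfac p s n : ℝ) * (rhoZero p s n : ℝ) := by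
      have := rhoHatZero_spec (p := p) hs hdeg
      exact_mod_cast this
    rw [e, abs_mul, abs_of_pos hT]
    have h0' : |(rhoZero p s n : ℝ)| ≤ R := by simpa [Rat.cast_abs] using h0
    calc (Tfac p s n : ℝ) * |(rhoZero p s n : ℝ)| ≤ (Tfac p s n : ℝ) * R := by gcongr
      _ = (Tfac p s n : ℝ) * 1 * R := by ring
      _ ≤ (Tfac p s n : ℝ) * (p : ℝ) ^ (p - 1 + s) * R := by gcongr
  · -- odd `i ≥ 3`: `|ρ̂_i p^i| = T|ρ_i|p^i ≤ T R p^{p−1+s}`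
    have hiA : i.val ≤ p - 1 + s := by have := i.isLt; omega
    have e : ((rhoHat p s n i.val : ℤ) : ℝ) = (Tfac p s n : ℝ) * (rho p s n i.val : ℝ) := by
      have := rhoHat_spec (p := p) hs n i.val
      exact_mod_cast this
    rw [Int.cast_mul, e, abs_mul, abs_mul, abs_of_pos hT, Int.cast_pow, Int.cast_natCast, abs_pow,
      abs_of_pos (by positivity : (0 : ℝ) < p)]
    have hi' : |(rho p s n i.val : ℝ)| ≤ R := by simpa [Rat.cast_abs] using hi i.val
    calc (Tfac p s n : ℝ) * |(rho p s n i.val : ℝ)| * (p : ℝ) ^ i.val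
        ≤ (Tfac p s n : ℝ) * R * (p : ℝ) ^ (p - 1 + s) := by
          gcongr
      _ = (Tfac p s n : ℝ) * (p : ℝ) ^ (p - 1 + s) * R := by ring
  · simp only [Int.cast_zero, abs_zero]; positivity

/-- Powers as exponentials: `x^k = exp(k log x)` (`x > 0`). [cite: LaiLupuSprang2025, §8 (exponential bookkeeping)] -/
theorem pow_eq_exp {x : ℝ} (hx : 0 < x) (k : ℕ) : x ^ k = Real.exp ((k : ℝ) * Real.log x) := by
  rw [Real.exp_nat_mul, Real.exp_log hx]

/-- Integer powers as exponentials: `x^z = exp(z log x)` (`x > 0`). [cite: LaiLupuSprang2025, §8 (exponential bookkeeping)] -/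
theorem zpow_eq_exp {x : ℝ} (hx : 0 < x) (z : ℤ) : x ^ z = Real.exp ((z : ℝ) * Real.log x) := by
  rw [← Real.rpow_intCast, Real.rpow_def_of_pos hx, mul_comm]

/-- The base-`p` digit sum of `n` is `≤ (p−1)(log_p n + 1)`. [cite: LaiLupuSprang2025, Lemma 6.3 (last display: "v_p(n!) = n/(p−1) + O(log n)")] -/
theorem digits_sum_le (n : ℕ) : (p.digits n).sum ≤ (p - 1) * (Nat.log p n + 1) := by
  have hp2 : 2 ≤ p := hpr.out.two_le
  rcases Nat.eq_zero_or_pos n with rfl | hn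
  · simp
  have hlen : (p.digits n).length = Nat.log p n + 1 := Nat.length_digits p n (by omega) (by omega)
  have h := List.sum_le_card_nsmul (p.digits n) (p - 1) fun d hd => by
    have := Nat.digits_lt_base (by omega : 1 < p) hd; omega
  rw [hlen, smul_eq_mul, mul_comm] at h
  exact h

/-- **Legendre: `p^{−s·v_p(n!)} ≤ exp(−(s log p/(p−1))·n)·(p(n+1))^s`** (`(p−1)v_p(n!) = n − (digit sum)`).
[cite: LaiLupuSprang2025, Lemma 6.3 (last display: "v_p(n!) = n/(p−1) + O(log n)", "|S_n|_p = p^{−(p+ps/(p−1))n+o(n)}")] -/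
theorem zpow_neg_padicValNat_factorial_le (s n : ℕ) :
    (p : ℝ) ^ (-((s * padicValNat p (n !) : ℕ) : ℤ)) ≤
      Real.exp (-((s : ℝ) * Real.log p / ((p : ℝ) - 1)) * n) * ((p : ℝ) * ((n : ℝ) + 1)) ^ s := by
  have hp2 : 2 ≤ p := hpr.out.two_le
  have hp0 : (0 : ℝ) < p := by exact_mod_cast hpr.out.pos
  have hp1 : (1 : ℝ) < p := by exact_mod_cast hpr.out.one_lt
  have hlogp : 0 ≤ Real.log p := Real.log_nonneg hp1.le
  set v := padicValNat p (n !) with hv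
  set L := Nat.log p n with hL
  have hleg := sub_one_mul_padicValNat_factorial (p := p) n
  have hσ := digits_sum_le (p := p) n
  have hσn := Nat.digit_sum_le p n
  -- `(p−1) v ≥ n − (p−1)(L+1)` as reals
  have hvR : (n : ℝ) / ((p : ℝ) - 1) - ((L : ℝ) + 1) ≤ (v : ℝ) := by
    have hq : (0 : ℝ) < (p : ℝ) - 1 := by linarith
    have h1 : ((p - 1 : ℕ) : ℝ) = (p : ℝ) - 1 := by rw [Nat.cast_sub (by omega)]; simp
    have h2' : (p - 1) * v = n - (p.digits n).sum := by rw [hv]; exact hleg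
    have h2 : (((p - 1) * v : ℕ) : ℝ) = ((n - (p.digits n).sum : ℕ) : ℝ) := by exact_mod_cast h2'
    rw [Nat.cast_sub hσn, Nat.cast_mul, h1] at h2
    have h3 : (((p.digits n).sum : ℕ) : ℝ) ≤ ((p : ℝ) - 1) * ((L : ℝ) + 1) := by
      have := hσ; rw [← hL] at this
      have h4 : (((p.digits n).sum : ℕ) : ℝ) ≤ (((p - 1) * (L + 1) : ℕ) : ℝ) := by exact_mod_cast this
      rw [Nat.cast_mul, h1, Nat.cast_add, Nat.cast_one] at h4; exact h4
    rw [div_sub' (ne_of_gt hq), div_le_iff₀ hq]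
    nlinarith
  -- `p^L ≤ n + 1`
  have hpL : (p : ℝ) ^ L ≤ (n : ℝ) + 1 := by
    rcases Nat.eq_zero_or_pos n with rfl | hn
    · simp [hL]
    · have := Nat.pow_log_le_self p (by omega : n ≠ 0)
      rw [← hL] at this
      have : ((p ^ L : ℕ) : ℝ) ≤ n := by exact_mod_cast this
      push_cast at this; linarith
  -- assemble: `p^{−sv} = exp(−s v log p) ≤ exp(−s(n/(p−1) − L − 1) log p) = exp(−(s log p/(p−1))n)·(p^L·p)^s`
  rw [zpow_eq_exp hp0]
  have hsv : (((-((s * v : ℕ) : ℤ)) : ℤ) : ℝ) * Real.log p ≤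
      -((s : ℝ) * Real.log p / ((p : ℝ) - 1)) * n + (s : ℝ) * (((L : ℝ) + 1) * Real.log p) := by
    push_cast
    have hs0 : (0 : ℝ) ≤ s := Nat.cast_nonneg s
    have := mul_le_mul_of_nonneg_left hvR (mul_nonneg hs0 hlogp)
    have e : -((s : ℝ) * Real.log p / ((p : ℝ) - 1)) * n + (s : ℝ) * (((L : ℝ) + 1) * Real.log p) =
        -((s : ℝ) * Real.log p * ((n : ℝ) / ((p : ℝ) - 1) - ((L : ℝ) + 1))) := by ring
    rw [e]
    linarith
  have hX : Real.exp ((s : ℝ) * (((L : ℝ) + 1) * Real.log p)) = ((p : ℝ) ^ L * p) ^ s := by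
    rw [Real.exp_nat_mul, show ((L : ℝ) + 1) * Real.log p = ((L + 1 : ℕ) : ℝ) * Real.log p by push_cast; ring,
      ← pow_eq_exp hp0, pow_succ]
  have hY : ((p : ℝ) ^ L * p) ^ s ≤ ((p : ℝ) * ((n : ℝ) + 1)) ^ s := by
    refine pow_le_pow_left₀ (by positivity) ?_ s
    rw [mul_comm]
    exact mul_le_mul_of_nonneg_left hpL hp0.le
  calc Real.exp ((((-((s * v : ℕ) : ℤ)) : ℤ) : ℝ) * Real.log p)
      ≤ Real.exp (-((s : ℝ) * Real.log p / ((p : ℝ) - 1)) * n + (s : ℝ) * (((L : ℝ) + 1) * Real.log p)) :=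
        Real.exp_le_exp.2 hsv
    _ = Real.exp (-((s : ℝ) * Real.log p / ((p : ℝ) - 1)) * n) * ((p : ℝ) ^ L * p) ^ s := by
        rw [Real.exp_add, hX]
    _ ≤ Real.exp (-((s : ℝ) * Real.log p / ((p : ℝ) - 1)) * n) * ((p : ℝ) * ((n : ℝ) + 1)) ^ s :=
        mul_le_mul_of_nonneg_left hY (Real.exp_pos _).le

/-- **`|S_n|_p` along `n = n(N_k)`, explicit**: `‖S_n‖_p ≤ A·p^{M₀+1}·(p(n+1))^s·(n+1)·exp(−((p+s) + s/(p−1))·log p·n)`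
(`A = p−1+s`; Lemma 6.3 = `norm_Sn`, `p^N ≤ (n+1)A`, `E' − 1 = (p+s)n + A − 1 − M₀`, Legendre).
[cite: LaiLupuSprang2025, Lemma 6.3 ("|S_n|_p = p^{−(p+ps/(p−1))n+o(n)}")] -/
theorem norm_Sn_nseq_le {s : ℕ} (hs : 1 ≤ s) (k : ℕ) :
    ‖Sn p s (nseq p s k)‖ ≤ ((p - 1 + s : ℕ) : ℝ) * (p : ℝ) ^ (M0 p s + 1) *
      (((p : ℝ) * (((nseq p s k : ℕ) : ℝ) + 1)) ^ s * (((nseq p s k : ℕ) : ℝ) + 1)) *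
      Real.exp (-((((p : ℝ) + s) + (s : ℝ) / ((p : ℝ) - 1)) * Real.log p) * (nseq p s k)) := by
  have hp2 : 2 ≤ p := hpr.out.two_le
  have hp0 : (0 : ℝ) < p := by exact_mod_cast hpr.out.pos
  have hp1 : (1 : ℝ) ≤ p := by exact_mod_cast hpr.out.one_lt.le
  set n := nseq p s k with hn
  have hsp := nseq_spec (p := p) hs k
  have hdeg2 := nseq_deg (p := p) hs k
  rw [← hn] at hsp hdeg2
  rw [norm_Sn hs (one_le_Nseq p s k) hsp hdeg2]
  -- (a) `p^N ≤ (n+1)A`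
  have ha : (p : ℝ) ^ (Nseq p s k : ℤ) ≤ ((n : ℝ) + 1) * ((p - 1 + s : ℕ) : ℝ) := by
    rw [zpow_natCast]
    have h1 : p ^ Nseq p s k ≤ (n + 1) * (p - 1 + s) := by
      rw [hsp]
      calc p ^ Nseq p s k ≤ p ^ Nseq p s k * (p - 1) := Nat.le_mul_of_pos_right _ (by omega)
        _ ≤ _ := by omega
    exact_mod_cast h1
  -- (b) `p^{−(E'−1)} = p^{M₀+1−A}·exp(−(p+s) log p · n) ≤ p^{M₀+1}·exp(…)`
  have hE : ((Eexp p s n - 1 : ℕ) : ℤ) = ((p : ℤ) + s) * n - ((M0 p s : ℤ) + 1 - (p - 1 + s : ℕ)) := by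
    have hK := (Kinf_spec hpr.out.one_lt.le (by omega : M0 p s + (p - 1) * n ≤ (p - 1 + s) * (n + 1))).2
    have hK1 := (kstar_eq hsp hdeg2).1
    have hc : (p - 1 + s) * (n + 1) = (n + 1) * (p - 1 + s) := Nat.mul_comm _ _
    have h1 : 1 ≤ Eexp p s n := by omega
    have h2 : Eexp p s n + M0 p s = n + (n + 1) * (p - 1 + s) := by unfold Eexp; omega
    have h3 : ((Eexp p s n - 1 : ℕ) : ℤ) = (Eexp p s n : ℤ) - 1 := by rw [Nat.cast_sub h1]; simp
    have h4 : ((Eexp p s n : ℕ) : ℤ) + M0 p s = n + (n + 1) * ((p - 1 + s : ℕ) : ℤ) := by exact_mod_cast h2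
    have h5 : ((p - 1 + s : ℕ) : ℤ) = (p : ℤ) - 1 + s := by rw [Nat.cast_add, Nat.cast_sub (by omega)]; simp
    rw [h3]; rw [h5] at h4 ⊢; linarith
  have hb : (p : ℝ) ^ (-((Eexp p s n - 1 : ℕ) : ℤ)) ≤ (p : ℝ) ^ (M0 p s + 1) *
      Real.exp (-(((p : ℝ) + s) * Real.log p) * n) := by
    rw [hE, zpow_eq_exp hp0, pow_eq_exp hp0, ← Real.exp_add]
    refine Real.exp_le_exp.2 ?_
    have hA0 : (0 : ℝ) ≤ ((p - 1 + s : ℕ) : ℝ) := Nat.cast_nonneg _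
    have hlogp : 0 ≤ Real.log p := Real.log_nonneg (by exact_mod_cast hpr.out.one_lt.le)
    push_cast
    nlinarith [mul_nonneg hA0 hlogp]
  -- (c) Legendre
  have hc := zpow_neg_padicValNat_factorial_le (p := p) s n
  -- assemble
  have hsplit : -((((p : ℝ) + s) + (s : ℝ) / ((p : ℝ) - 1)) * Real.log p) * n =
      -(((p : ℝ) + s) * Real.log p) * n + -((s : ℝ) * Real.log p / ((p : ℝ) - 1)) * n := by ring
  rw [hsplit, Real.exp_add]
  calc (p : ℝ) ^ (Nseq p s k : ℤ) * ((p : ℝ) ^ (-((Eexp p s n - 1 : ℕ) : ℤ)) *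
        (p : ℝ) ^ (-((s * padicValNat p (n !) : ℕ) : ℤ)))
      ≤ (((n : ℝ) + 1) * ((p - 1 + s : ℕ) : ℝ)) * (((p : ℝ) ^ (M0 p s + 1) * Real.exp (-(((p : ℝ) + s) * Real.log p) * n)) *
        (Real.exp (-((s : ℝ) * Real.log p / ((p : ℝ) - 1)) * n) * ((p : ℝ) * ((n : ℝ) + 1)) ^ s)) := by
        gcongr
    _ = _ := by ring

end LinearForms

/-! ## §5. Proof of Theorem 1.1 -/

section Main

variable {p : ℕ} [hpr : Fact p.Prime]

/-- `κ_p := (p−1−ϖ_p) − s_p·D_p < 0`, the logarithm of the left side of (sss). [cite: LaiLupuSprang2025, §8 (sss)] -/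
def kappa (p : ℕ) : ℝ := ((p : ℝ) - 1 - llsVarpi p) - (sPar p : ℝ) * llsD p

omit hpr in
/-- The exponent identity behind (sss): `A − ϖ + s log 2 + p log p − (p+s+s/(p−1)) log p = κ_p` (`A = p−1+s`).
[cite: LaiLupuSprang2025, §8 ("2^s p^p e^{p−1+s−ϖ_p} p^{−(p+ps/(p−1))} < 1")] -/
theorem exponent_identity (hp5 : 5 ≤ p) :
    (((p - 1 + sPar p : ℕ) : ℝ)) - llsVarpi p + ((sPar p : ℝ) * Real.log 2 + (p : ℝ) * Real.log p) -
      (((p : ℝ) + sPar p) + (sPar p : ℝ) / ((p : ℝ) - 1)) * Real.log p = kappa p := by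
  have hp1 : (1 : ℝ) < p := by exact_mod_cast (show 1 < p by omega)
  have hq : (p : ℝ) - 1 ≠ 0 := by linarith
  rw [kappa, llsD, Nat.cast_add, Nat.cast_sub (by omega : 1 ≤ p), Nat.cast_one]
  field_simp
  ring

/-- **The decisive estimate** (§8 with `s = s_p`): for all large `k` and every index `i`,
`|l_{n_k,i}|·|Λ_{n_k}|_p ≤ exp(κ_p·n_k/2)` — from `d_n = e^{n+o(n)}` (PNT), `Φ_n = e^{ϖ_p n+o(n)}` (Lemma 7.3),
`max|ρ_i| ≤ 2^{sn}p^{pn+o(n)}` (Lemma 7.1) and `|S_n|_p = p^{−(p+ps/(p−1))n+o(n)}` (Lemma 6.3).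
[cite: LaiLupuSprang2025, §8 ("max_i |ρ̂_i| · |Λ_n|_p → 0 as n ∈ I and n → ∞")] -/
theorem eventually_forms_small (hp5 : 5 ≤ p) :
    ∀ᶠ k : ℕ in atTop, ∀ i : Fin (p - 1 + sPar p + 1),
      (|lVec p (sPar p) (nseq p (sPar p) k) i| : ℝ) *
        ‖∑ j, (lVec p (sPar p) (nseq p (sPar p) k) j : ℚ_[p]) * xiVec p (p - 1 + sPar p) j‖ ≤
        Real.exp (kappa p / 2 * nseq p (sPar p) k) := by
  set s := sPar p with hs_def
  have hs : 1 ≤ s := one_le_sPar p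
  have hp2 : 2 ≤ p := by omega
  have hp0 : (0 : ℝ) < p := by exact_mod_cast (show 0 < p by omega)
  have hκ : kappa p < 0 := key_exponent_neg hp5
  have hA0 : (0 : ℝ) ≤ ((p - 1 + s : ℕ) : ℝ) := Nat.cast_nonneg _
  set ε : ℝ := -kappa p / (2 * (((p - 1 + s : ℕ) : ℝ) + 3)) with hε_def
  have hε : 0 < ε := div_pos (by linarith) (by positivity)
  have hεA : ε * (((p - 1 + s : ℕ) : ℝ) + 3) = -kappa p / 2 := by
    rw [hε_def]; field_simp
  -- the eventual inputs, in the variable `n`, pulled back along `n_k → ∞`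
  have E1 : ∀ᶠ n : ℕ in atTop, (Nat.lcmUpto n : ℝ) ≤ Real.exp ((1 + ε) * n) := by
    have h := (Transcendental.tendsto_log_lcmUpto_div).eventually
      (eventually_lt_nhds (show (1 : ℝ) < 1 + ε by linarith))
    filter_upwards [h, eventually_gt_atTop 0] with n hn hn0
    have hpos : (0 : ℝ) < Nat.lcmUpto n := by exact_mod_cast Nat.lcmUpto_pos n
    have hnR : (0 : ℝ) < n := by exact_mod_cast hn0
    rw [div_lt_iff₀ hnR] at hn
    rw [← Real.log_le_iff_le_exp hpos]
    linarith
  have E2 := eventually_exp_le_PhiL (p := p) hp2 hε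
  have E3 := eventually_abs_rho_le hpr.out hs hε
  have E4 := eventually_poly_le_exp
    (C := (p : ℝ) ^ (p - 1 + s) * (((p - 1 + s : ℕ) : ℝ) * (p : ℝ) ^ (M0 p s + 1) * (p : ℝ) ^ s)) (s + 1) hε
  have hT := tendsto_nseq (p := p) hs
  filter_upwards [hT.eventually E1, hT.eventually E2, hT.eventually E3, hT.eventually E4] with k h1 h2 h3 h4 i
  set n := nseq p s k with hn_def
  have hn0 : (0 : ℝ) ≤ n := Nat.cast_nonneg n
  have hdeg2 := nseq_deg (p := p) hs k
  rw [← hn_def] at hdeg2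
  have hdeg : M0 p s + (p - 1) * n < (p - 1 + s) * (n + 1) := by omega
  obtain ⟨h30, h3i⟩ := h3
  -- (i) `|l_i| ≤ T p^A R`
  set R : ℝ := (2 : ℝ) ^ (s * n) * (p : ℝ) ^ (p * n) * Real.exp (ε * n) with hR
  have hl := abs_lVec_le (p := p) hs hdeg h30 h3i i
  -- (ii) `|Λ| ≤ |S_n|`
  have hΛ := norm_sum_lVec_le (p := p) hp5 hs k
  rw [← hn_def] at hΛ
  -- (iii) `T ≤ exp((1+ε)An)·exp(−(ϖ−ε)n)`
  have hTfac : (Tfac p s n : ℝ) ≤ Real.exp ((1 + ε) * n) ^ (p - 1 + s) * Real.exp (-((llsVarpi p - ε) * n)) := by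
    have hΦ : (0 : ℝ) < (PhiL p n : ℝ) := by exact_mod_cast PhiL_pos p n
    have e : (Tfac p s n : ℝ) = (Nat.lcmUpto n : ℝ) ^ (p - 1 + s) * (1 / (PhiL p n : ℝ)) := by
      rw [Tfac]; push_cast; ring
    rw [e, Real.exp_neg, ← one_div]
    refine mul_le_mul (pow_le_pow_left₀ (by positivity) h1 _) (one_div_le_one_div_of_le (Real.exp_pos _) h2)
      (by positivity) (by positivity)
  -- (iv) `|S_n|`
  have hSn := norm_Sn_nseq_le (p := p) hs k
  rw [← hn_def] at hSn
  -- (v) assemble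
  have hTn : 0 ≤ (Tfac p s n : ℝ) := by exact_mod_cast (Tfac_pos p s n).le
  calc (|(lVec p s n i : ℝ)|) * ‖∑ j, (lVec p s n j : ℚ_[p]) * xiVec p (p - 1 + s) j‖
      ≤ ((Tfac p s n : ℝ) * (p : ℝ) ^ (p - 1 + s) * R) * ‖Sn p s n‖ :=
        mul_le_mul hl hΛ (norm_nonneg _) (by positivity)
    _ ≤ ((Real.exp ((1 + ε) * n) ^ (p - 1 + s) * Real.exp (-((llsVarpi p - ε) * n))) * (p : ℝ) ^ (p - 1 + s) * R) *
        (((p - 1 + s : ℕ) : ℝ) * (p : ℝ) ^ (M0 p s + 1) * (((p : ℝ) * ((n : ℝ) + 1)) ^ s * ((n : ℝ) + 1)) *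
          Real.exp (-((((p : ℝ) + s) + (s : ℝ) / ((p : ℝ) - 1)) * Real.log p) * n)) := by
        gcongr
    _ = ((p : ℝ) ^ (p - 1 + s) * (((p - 1 + s : ℕ) : ℝ) * (p : ℝ) ^ (M0 p s + 1) * (p : ℝ) ^ s) *
          ((n : ℝ) + 1) ^ (s + 1)) *
        (Real.exp ((((p - 1 + s : ℕ) : ℝ)) * ((1 + ε) * n)) * Real.exp (-((llsVarpi p - ε) * n)) *
          Real.exp (((s * n : ℕ) : ℝ) * Real.log 2) * Real.exp (((p * n : ℕ) : ℝ) * Real.log p) * Real.exp (ε * n) *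
          Real.exp (-((((p : ℝ) + s) + (s : ℝ) / ((p : ℝ) - 1)) * Real.log p) * n)) := by
        rw [hR, pow_eq_exp (by norm_num : (0 : ℝ) < 2), pow_eq_exp hp0 (p * n), ← Real.exp_nat_mul,
          mul_pow (p : ℝ) ((n : ℝ) + 1) s]
        ring
    _ ≤ Real.exp (ε * n) *
        (Real.exp ((((p - 1 + s : ℕ) : ℝ)) * ((1 + ε) * n)) * Real.exp (-((llsVarpi p - ε) * n)) *
          Real.exp (((s * n : ℕ) : ℝ) * Real.log 2) * Real.exp (((p * n : ℕ) : ℝ) * Real.log p) * Real.exp (ε * n) *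
          Real.exp (-((((p : ℝ) + s) + (s : ℝ) / ((p : ℝ) - 1)) * Real.log p) * n)) :=
        mul_le_mul_of_nonneg_right h4 (by positivity)
    _ = Real.exp (kappa p / 2 * n) := by
        simp only [← Real.exp_add]
        congr 1
        have hid := exponent_identity hp5
        rw [← hs_def] at hid
        simp only [Nat.cast_mul]
        have e : ε * n + ((((p - 1 + s : ℕ) : ℝ)) * ((1 + ε) * n) + -((llsVarpi p - ε) * n) +
            (s : ℝ) * n * Real.log 2 + (p : ℝ) * n * Real.log p + ε * n +
            -((((p : ℝ) + s) + (s : ℝ) / ((p : ℝ) - 1)) * Real.log p) * n) =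
            ((((p - 1 + s : ℕ) : ℝ)) - llsVarpi p + ((s : ℝ) * Real.log 2 + (p : ℝ) * Real.log p) -
              (((p : ℝ) + s) + (s : ℝ) / ((p : ℝ) - 1)) * Real.log p) * n +
              (ε * (((p - 1 + s : ℕ) : ℝ) + 3)) * n := by ring
        rw [e, hid, hεA]
        ring

/-- `exp(κ_p n_k/2) → 0`. [cite: LaiLupuSprang2025, §8 ("→ 0 as n ∈ I and n → ∞")] -/
theorem tendsto_exp_kappa (hp5 : 5 ≤ p) :
    Tendsto (fun k : ℕ => Real.exp (kappa p / 2 * nseq p (sPar p) k)) atTop (𝓝 0) := by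
  have hκ : kappa p / 2 < 0 := by have := key_exponent_neg hp5; rw [kappa]; linarith
  have h1 : Tendsto (fun k : ℕ => kappa p / 2 * (nseq p (sPar p) k : ℝ)) atTop atBot :=
    (tendsto_natCast_atTop_atTop.comp (tendsto_nseq (p := p) (one_le_sPar p))).const_mul_atTop_of_neg hκ
  exact Real.tendsto_exp_atBot.comp h1

end Main

end Literature.NumberTheory.Irrationality.LaiLupuSprang2025

namespace Literature.NumberTheory.Irrationality.PAdicZetaValues

open Literature.NumberTheory.Irrationality.LaiLupuSprang2025

/-- **Lai–Lupu–Sprang 2025, Theorem 1.1 — DISCHARGED**: for every prime `p ≥ 5` there is an odd `i ∈ [3, c_p]` with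
`ζ_p(i) ∉ ℚ`, `c_p = p + (p−1−ϖ_p)/((p/(p−1))log p − 1 − log 2)`.  The printed §8: the criterion Lemma 2.1
(`PAdicZetaValues.exists_isIrrational_of_linearForms`) applied to the linear forms `Λ_n = ρ̂_0 + Σ_{odd i} ρ̂_i p^i ζ_p(i)`
(`Λ_{n_k} ≠ 0` by Lemma 6.3, `max|ρ̂_i|·|Λ_n|_p ≤ e^{κ_p n/2} → 0` by Lemmas 6.3, 7.1, 7.3 and the prime number theorem, with
`s = ⌊(p−1−ϖ_p)/D_p⌋ + 1`), and `p − 1 + s ≤ c_p`. [cite: LaiLupuSprang2025, Thm 1.1 and §8] -/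
theorem laiLupuSprang2025_theorem11_holds : laiLupuSprang2025_theorem11 := by
  intro p _ hp5
  set s := sPar p with hs_def
  have hs : 1 ≤ s := one_le_sPar p
  -- the linear forms `Λ_{n_k}`: for every `ε > 0` some `k` works
  have hforms : ∀ ε : ℝ, 0 < ε → ∃ l : Fin (p - 1 + s + 1) → ℤ,
      (∑ i, (l i : ℚ_[p]) * xiVec p (p - 1 + s) i) ≠ 0 ∧
        ∀ i, (|l i| : ℝ) * ‖∑ j, (l j : ℚ_[p]) * xiVec p (p - 1 + s) j‖ < ε := by
    intro ε hε
    obtain ⟨k, hk1, hk2⟩ := ((eventually_forms_small hp5).and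
      ((tendsto_exp_kappa hp5).eventually (gt_mem_nhds hε))).exists
    exact ⟨lVec p s (nseq p s k), sum_lVec_ne_zero hp5 hs k, fun j => lt_of_le_of_lt (hk1 j) hk2⟩
  obtain ⟨i, hi⟩ := exists_isIrrational_of_linearForms p (xiVec p (p - 1 + s)) hforms
  -- the irrational coordinate is some `ζ_p(i)`, `i` odd, `3 ≤ i ≤ p−1+s ≤ c_p`
  have hval : Odd i.val ∧ 3 ≤ i.val := by
    by_contra h
    unfold xiVec at hi
    split_ifs at hi with h0
    · exact not_isIrrational_ratCast p 1 (by simpa using hi)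
    · exact not_isIrrational_ratCast p 0 (by simpa using hi)
  refine ⟨i.val, hval.1, hval.2, ?_, ?_⟩
  · have h1 : (i.val : ℝ) ≤ ((p - 1 + s : ℕ) : ℝ) := by
      exact_mod_cast (show i.val ≤ p - 1 + s by have := i.isLt; omega)
    exact h1.trans (pred_add_sPar_le_llsC hp5)
  · have hne : i.val ≠ 0 := by have := hval.2; omega
    simpa [xiVec, hne, hval] using hi

end Literature.NumberTheory.Irrationality.PAdicZetaValues

end
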